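import Summits.ABC.ABC.Theses.IneffectiveSubspace

/-!
# Stub `stub_calibration` of line `Sketch` — crux `IneffectiveSubspace.DepthCountedABC` (stmt-ABC-14938)

CALIBRATION OF THE TWO SHALLOWEST CELLS (where "nothing" sits).  The crux is abc with a constant
`C(K, ε)` on the cells `ω₅(abc) := #{p : v_p(abc) ≥ 5} ≤ K`.  This stub records the two free facts:

* Cell `ω₅ = 0` (the 5-free cell: every prime exponent of `abc` is `≤ 4`) at exponent 2, constant 2:
  `c² ≤ 2·abc` (as `a, b ≥ 1`, `c = a + b ≤ 2ab`) and `abc = ∏ p^{v_p} ≤ ∏ p⁴ = rad(abc)⁴`, so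
  `c² ≤ 2·rad(abc)⁴`.
* Cell `ω₅ ≤ 1` at exponent 4, constant 2: with at most one deep prime `q`, if `c` is 5-free then
  `c ≤ rad(c)⁴ ≤ rad(abc)⁴`; otherwise the deep prime `q` divides `c`, and any deep prime of `a` (or `b`)
  would be a deep prime of `abc`, hence `= q`, hence a common divisor of `a` (or `b`) and `c` —
  impossible as `gcd(a, c) = gcd(b, c) = 1`.  So `a, b` are 5-free, `a, b ≤ rad(abc)⁴` and
  `c = a + b ≤ 2·rad(abc)⁴`.

Sources: skeleton `Cruxes/DepthCountedABC/Lines/Sketch.lean` of lead `prover-line-stmt-ABC-14938-0`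
(stub `stub_calibration`).  The proofs are ADAPTED from the workfile
`Cruxes/DepthCountedABC/SketchIdeator2.lean` (planner-cruxidea-stmt-ABC-14938-2-0), section
`CalibrationProofs` (`le_radical_pow_of_factorization_le`, `sq_le_two_mul_prod`,
`radical_le_radical_of_dvd`, `le_radical_pow_four_of_dvd`, `mem_deep_of_factor`,
`calibrationZero_holds`, `calibrationOne_holds`), with the 5-free predicate replaced by the crux's
`card (filter) = 0` via `Finset.card_eq_zero` / `Finset.filter_eq_empty_iff`.  Mathlib only
(`Nat.prod_factorization_pow_eq_self`, `Nat.support_factorization`, `Nat.radical_eq_prod_primeFactors`,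
`UniqueFactorizationMonoid.radical_dvd_radical`, `Nat.radical_pos`, `Nat.factorization_le_iff_dvd`,
`Nat.primeFactors_mono`, `Finset.prod_le_prod'`, `Finset.prod_pow`, `Finset.card_le_one`) and
`Literature.NumberTheory.DiophantineGeometry.rad_def`.
Deliberately NOT here: the cells `ω₅ ≤ K` for `K ≥ 2` at any exponent, and anything at exponent
`1 + ε` (the other stubs of the line).
-/

-- `Summit.<Summit>.<Problem>` is the mandated summit-side namespace (CONVENTIONS §2); for the
-- single-conjunct summit `ABC` the two coincide, so the duplicate `ABC.ABC` is deliberate.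
set_option linter.dupNamespace false

namespace Summit.ABC.ABC.Theorems.DepthCountedABC

open scoped BigOperators

section Calibration
-- adapted from Cruxes/DepthCountedABC/SketchIdeator2.lean (planner-cruxidea-stmt-ABC-14938-2-0)
open UniqueFactorizationMonoid (radical)
open Literature.NumberTheory.DiophantineGeometry (IsABCTriple rad rad_def)

/-- If every prime exponent of `n ≠ 0` is at most `m`, then `n ≤ rad(n)^m`. [folklore] -/
theorem calibration_le_radical_pow_of_factorization_le {n m : ℕ} (hn : n ≠ 0)
    (h : ∀ p ∈ n.primeFactors, n.factorization p ≤ m) : n ≤ (radical n) ^ m := by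
  have hself : ∏ p ∈ n.primeFactors, p ^ n.factorization p = n := by
    conv_rhs => rw [← Nat.prod_factorization_pow_eq_self hn]
    rw [Finsupp.prod, Nat.support_factorization]
  calc n = ∏ p ∈ n.primeFactors, p ^ n.factorization p := hself.symm
    _ ≤ ∏ p ∈ n.primeFactors, p ^ m := by
        apply Finset.prod_le_prod'
        intro p hp
        exact Nat.pow_le_pow_right (Nat.pos_of_mem_primeFactors hp) (h p hp)
    _ = (∏ p ∈ n.primeFactors, p) ^ m := Finset.prod_pow _ _ _
    _ = (radical n) ^ m := by rw [Nat.radical_eq_prod_primeFactors]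

/-- `c² ≤ 2·abc` for an abc triple (`a, b ≥ 1`, `c = a + b ≤ 2ab`). [folklore] -/
theorem calibration_sq_le_two_mul_prod {a b c : ℕ} (h : IsABCTriple a b c) :
    c ^ 2 ≤ 2 * (a * b * c) := by
  obtain ⟨ha, hb, hsum, -⟩ := h
  subst hsum
  obtain ⟨a', rfl⟩ : ∃ a', a = a' + 1 := ⟨a - 1, by omega⟩
  obtain ⟨b', rfl⟩ : ∃ b', b = b' + 1 := ⟨b - 1, by omega⟩
  have key : (a' + 1) + (b' + 1) ≤ 2 * ((a' + 1) * (b' + 1)) := by nlinarith [Nat.zero_le (a' * b')]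
  calc ((a' + 1) + (b' + 1)) ^ 2 = ((a' + 1) + (b' + 1)) * ((a' + 1) + (b' + 1)) := by ring
    _ ≤ (2 * ((a' + 1) * (b' + 1))) * ((a' + 1) + (b' + 1)) := Nat.mul_le_mul_right _ key
    _ = 2 * ((a' + 1) * (b' + 1) * ((a' + 1) + (b' + 1))) := by ring

/-- The radical of a factor of `y ≠ 0` is at most the radical of `y` (in `ℕ`). [folklore] -/
theorem calibration_radical_le_radical_of_dvd {x y : ℕ} (hy : y ≠ 0) (h : x ∣ y) :
    radical x ≤ radical y :=
  Nat.le_of_dvd (Nat.radical_pos y) (UniqueFactorizationMonoid.radical_dvd_radical h hy)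

/-- A shallow (5-free) factor `x` of `n ≠ 0` is at most `rad(n)⁴`. [folklore] -/
theorem calibration_le_radical_pow_four_of_dvd {x n : ℕ} (hn : n ≠ 0) (hdvd : x ∣ n)
    (hx : ∀ p ∈ x.primeFactors, x.factorization p ≤ 4) : x ≤ (radical n) ^ 4 := by
  have hx0 : x ≠ 0 := by rintro rfl; exact hn (zero_dvd_iff.mp hdvd)
  calc x ≤ (radical x) ^ 4 := calibration_le_radical_pow_of_factorization_le hx0 hx
    _ ≤ (radical n) ^ 4 := Nat.pow_le_pow_left (calibration_radical_le_radical_of_dvd hn hdvd) 4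

/-- If a factor `x ∣ n` (`n ≠ 0`) has a prime `p` at depth `≥ 5`, then `p` is a deep prime of `n`
(`v_p(n) ≥ 5`). [folklore] -/
theorem calibration_mem_deep_of_factor {x n p : ℕ} (hn : n ≠ 0) (hdvd : x ∣ n)
    (hp : p ∈ x.primeFactors) (h5 : 5 ≤ x.factorization p) :
    p ∈ n.primeFactors.filter (fun p => 5 ≤ n.factorization p) := by
  have hx0 : x ≠ 0 := by rintro rfl; exact hn (zero_dvd_iff.mp hdvd)
  rw [Finset.mem_filter]
  refine ⟨Nat.primeFactors_mono hdvd hn hp, le_trans h5 ?_⟩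
  exact (Nat.factorization_le_iff_dvd hx0 hn).mpr hdvd p

/-- The bridge from the crux's cell condition to 5-freeness: if `#{p ∣ n : v_p(n) ≥ 5} = 0` then
every prime exponent of `n` is at most `4`. [folklore] -/
theorem calibration_fiveFree_of_card_eq_zero {n : ℕ}
    (h0 : (n.primeFactors.filter (fun p => 5 ≤ n.factorization p)).card = 0) :
    ∀ p ∈ n.primeFactors, n.factorization p ≤ 4 := by
  intro p hp
  have hnot := Finset.filter_eq_empty_iff.mp (Finset.card_eq_zero.mp h0) hp
  omega

/-- CALIBRATION OF CELL 0: on a 5-free abc triple (`#{p : v_p(abc) ≥ 5} = 0`) abc holds at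
exponent 2 with constant 2, `c² ≤ 2·rad(abc)⁴` (`c² ≤ 2abc ≤ 2·rad(abc)⁴`). [folklore] -/
theorem calibration_zero (a b c : ℕ) (h : IsABCTriple a b c)
    (h0 : ((a * b * c).primeFactors.filter (fun p => 5 ≤ (a * b * c).factorization p)).card = 0) :
    c ^ 2 ≤ 2 * (rad a b c) ^ 4 := by
  have hne : a * b * c ≠ 0 := by
    obtain ⟨ha, hb, hsum, -⟩ := h
    have hc : 0 < c := by omega
    positivity
  calc c ^ 2 ≤ 2 * (a * b * c) := calibration_sq_le_two_mul_prod h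
    _ ≤ 2 * (radical (a * b * c)) ^ 4 :=
        Nat.mul_le_mul_left 2 (calibration_le_radical_pow_of_factorization_le hne
          (calibration_fiveFree_of_card_eq_zero h0))
    _ = 2 * (rad a b c) ^ 4 := by rw [rad_def]

/-- CALIBRATION OF CELL 1: on an abc triple with at most one prime at depth `≥ 5` in `abc`, abc holds
at exponent 4 with constant 2, `c ≤ 2·rad(abc)⁴` (if `c` is 5-free, `c ≤ rad(abc)⁴`; else the one
deep prime divides `c`, so `a, b` are 5-free and `c = a + b ≤ 2·rad(abc)⁴`). [folklore] -/
theorem calibration_one (a b c : ℕ) (h : IsABCTriple a b c)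
    (hK : ((a * b * c).primeFactors.filter (fun p => 5 ≤ (a * b * c).factorization p)).card ≤ 1) :
    c ≤ 2 * (rad a b c) ^ 4 := by
  obtain ⟨ha, hb, hsum, hcop⟩ := h
  have hc : 0 < c := by omega
  have hne : a * b * c ≠ 0 := by positivity
  have hac : Nat.Coprime a c := by
    rw [← hsum, Nat.coprime_self_add_right]; exact hcop
  have hbc : Nat.Coprime b c := by
    rw [← hsum, add_comm, Nat.coprime_self_add_right]; exact hcop.symm
  have hda : a ∣ a * b * c := dvd_mul_of_dvd_left (dvd_mul_right a b) c
  have hdb : b ∣ a * b * c := dvd_mul_of_dvd_left (dvd_mul_left b a) c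
  have hdc : c ∣ a * b * c := dvd_mul_left c (a * b)
  rw [rad_def]
  set D := (a * b * c).primeFactors.filter (fun p => 5 ≤ (a * b * c).factorization p) with hD
  by_cases hc5 : ∀ p ∈ c.primeFactors, c.factorization p ≤ 4
  · calc c ≤ (radical (a * b * c)) ^ 4 := calibration_le_radical_pow_four_of_dvd hne hdc hc5
      _ ≤ 2 * (radical (a * b * c)) ^ 4 := Nat.le_mul_of_pos_left _ (by norm_num)
  · push Not at hc5
    obtain ⟨q, hq, hq5⟩ := hc5
    have hqD : q ∈ D := calibration_mem_deep_of_factor hne hdc hq hq5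
    -- every member coprime to `c` is shallow: a deep prime of it would be `q`, dividing it and `c`
    have shallow : ∀ x : ℕ, x ∣ a * b * c → Nat.Coprime x c →
        ∀ p ∈ x.primeFactors, x.factorization p ≤ 4 := by
      intro x hxd hxc p hp
      by_contra hlt
      push Not at hlt
      have hpD : p ∈ D := calibration_mem_deep_of_factor hne hxd hp hlt
      have hpq : p = q := Finset.card_le_one.mp hK p hpD q hqD
      have hpx : p ∣ x := Nat.dvd_of_mem_primeFactors hp
      have hpc : p ∣ c := hpq ▸ Nat.dvd_of_mem_primeFactors hq
      have h1 : p = 1 := Nat.Coprime.eq_one_of_dvd (Nat.Coprime.coprime_dvd_left hpx hxc) hpc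
      exact (Nat.prime_of_mem_primeFactors hp).one_lt.ne' h1
    have hale : a ≤ (radical (a * b * c)) ^ 4 :=
      calibration_le_radical_pow_four_of_dvd hne hda (shallow a hda hac)
    have hble : b ≤ (radical (a * b * c)) ^ 4 :=
      calibration_le_radical_pow_four_of_dvd hne hdb (shallow b hdb hbc)
    omega

end Calibration

/-- **Stub `stub_calibration` (calibration of the shallow cells) of line `Sketch`, crux
`DepthCountedABC` (stmt-ABC-14938):** (i) on the 5-free cell `#{p : v_p(abc) ≥ 5} = 0` every abc
triple satisfies `c² ≤ 2·rad(abc)⁴` (abc at exponent 2, constant 2, for free); (ii) on the cell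
`#{p : v_p(abc) ≥ 5} ≤ 1` every abc triple satisfies `c ≤ 2·rad(abc)⁴` (abc at exponent 4, constant 2,
for free). [folklore] -/
theorem stub_calibration :
    (∀ a b c : ℕ, Literature.NumberTheory.DiophantineGeometry.IsABCTriple a b c →
      ((a * b * c).primeFactors.filter (fun p => 5 ≤ (a * b * c).factorization p)).card = 0 →
      c ^ 2 ≤ 2 * (Literature.NumberTheory.DiophantineGeometry.rad a b c) ^ 4) ∧
    (∀ a b c : ℕ, Literature.NumberTheory.DiophantineGeometry.IsABCTriple a b c →
      ((a * b * c).primeFactors.filter (fun p => 5 ≤ (a * b * c).factorization p)).card ≤ 1 →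
      c ≤ 2 * (Literature.NumberTheory.DiophantineGeometry.rad a b c) ^ 4) :=
  ⟨calibration_zero, calibration_one⟩

end Summit.ABC.ABC.Theorems.DepthCountedABC
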